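import Literature.Probability.RandomPlanarGeometry.HexSAWStripSurfaceThresholdExcess
import Literature.Probability.RandomPlanarGeometry.HexSAWStripWidthOne
import HarnessLib

/-!
# Strip thresholds for honeycomb SAW adsorption — rider to «HEX-YT-RATE»: the method-sharp constant `√2/2`
# `y_{T+1} − y* ≤ (√2/2) · B_T(x_c,1) / (1 − x_c² B_T(x_c,1)) ≤ (√2/2) B_T + (√2 − 1) B_T²`

Rider of lane pub-sawmu (a-idea-1 gen 23) on the tree's `HexSAWStripSurfaceThresholdExcess.lean` (Part I «HEX-YT-RATE», p370814) and
`HexSAWStripWidthOne.lean` (`stripBlim_one_eq : B_1(x_c,1) = 2√2 − 2`, used only for the `T = 1` instance).  Part I solves the §4.5 display of Beaton–Bousquet-Mélou–de Gier–Duminil-Copin–Guttmann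
(arXiv:1109.0358v5 p. 15, (20) + the display after it) for `y` — `stripYT_succ_le_div : y_{T+1} ≤ y*/(1 − x_c² B_T)` — and then
spends the identity `y*·x_c²/(1 − x_c²) = 1` to get the round bound `y_{T+1} − y* ≤ B_T`.  Subtracting `y*` WITHOUT that loss gives the
constant the method actually delivers, `y*·x_c² = (1+√2)(1 − √2/2) = √2/2 = 0.7071…`:

* `yStar_mul_hexCriticalFugacity_sq : y* · x_c² = √2/2`;
* ★ `stripYT_succ_sub_yStar_le_sharp : y_{T+1} − y* ≤ (√2/2) · B_T / (1 − x_c² B_T)` (`T ≥ 1`); at `T = 1` this is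
  `stripYT_two_sub_yStar_le_sharp_one : y_2 − y* ≤ (4+√2)/7 = 0.7735…` — against the exact value `(3+√2)/7 = 0.6306…`
  (tree `HexSAWStripSurfaceWidthTwo.stripYT_two`) and Part I's round bound `B_1 = 2√2 − 2 = 0.8284…`;
* `stripYT_succ_sub_yStar_le_quad : y_{T+1} − y* ≤ (√2/2) B_T + (√2 − 1) B_T²` (`1/(1−u) ≤ 1 + 2u` for `u = x_c² B_T ≤ x_c² < 1/2`) — the
  asymptotic form: the excess is at most `(√2/2 + o(1)) · B_T(x_c,1)`.

[cite: BeatonBousquetMelouDeGierDuminilCopinGuttmann2014, §4.5 (arXiv v5 p. 15: (20) and the display after it, printed at y = y_c) with Theorem 10 (p. 14) and Corollary 8 (p. 12)] —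
finite-T excess bounds: lane derivations, not in print.
-/

noncomputable section

namespace Literature.Probability.RandomPlanarGeometry.SAW.HV

variable {T : ℕ}

/-- `y* · x_c² = √2/2` (`y* = 1 + √2`, `x_c² = 1 − √2/2`). [folklore] [cite: DuminilCopinSmirnov2012, §1 ("x_c := 1/√(2+√2)")] -/
theorem yStar_mul_hexCriticalFugacity_sq : yStar * hexCriticalFugacity ^ 2 = Real.sqrt 2 / 2 := by
  rw [hexCriticalFugacity_sq_eq_one_sub]
  unfold yStar
  have h2 : Real.sqrt 2 * Real.sqrt 2 = 2 := Real.mul_self_sqrt (by norm_num)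
  nlinarith

/-- ★ **The method-sharp excess bound: `y_{T+1} − y* ≤ (√2/2) · B_T(x_c,1) / (1 − x_c² B_T(x_c,1))`** (`T ≥ 1`) — Part I's
`y_{T+1} ≤ y*/(1 − x_c² B_T)` with `y*` subtracted exactly (`y*/(1−u) − y* = y*·u/(1−u)`, `y*·x_c² = √2/2`).
[cite: BeatonBousquetMelouDeGierDuminilCopinGuttmann2014, §4.5 (arXiv v5 p. 15: (20) and the display after it, printed at y = y_c; solved for y) with Theorem 10 (p. 14); finite-T excess bound — lane derivation, not in print] -/
theorem stripYT_succ_sub_yStar_le_sharp (hT : 1 ≤ T) :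
    stripYT (T + 1) - yStar ≤
      Real.sqrt 2 / 2 * stripBlim T / (1 - hexCriticalFugacity ^ 2 * stripBlim T) := by
  have hD := one_sub_sq_mul_stripBlim_pos hT
  have h := stripYT_succ_le_div hT
  have e : yStar / (1 - hexCriticalFugacity ^ 2 * stripBlim T) - yStar =
      yStar * hexCriticalFugacity ^ 2 * stripBlim T / (1 - hexCriticalFugacity ^ 2 * stripBlim T) := by
    field_simp
    ring
  rw [← yStar_mul_hexCriticalFugacity_sq]
  linarith [e]

/-- **Asymptotic form: `y_{T+1} − y* ≤ (√2/2)·B_T(x_c,1) + (√2 − 1)·B_T(x_c,1)²`** (`T ≥ 1`), from the sharp bound and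
`1/(1 − u) ≤ 1 + 2u` for `u = x_c² B_T ≤ x_c² = 1 − √2/2 < 1/2` (`B_T ≤ 1`), with `√2·x_c² = √2 − 1`.
[cite: BeatonBousquetMelouDeGierDuminilCopinGuttmann2014, §4.5 (arXiv v5 p. 15) with Theorem 10 (p. 14); finite-T excess bound — lane derivation, not in print] [cite: DuminilCopinSmirnov2012, §3, eq. (4) (B_T ≤ 1)] -/
theorem stripYT_succ_sub_yStar_le_quad (hT : 1 ≤ T) :
    stripYT (T + 1) - yStar ≤ Real.sqrt 2 / 2 * stripBlim T + (Real.sqrt 2 - 1) * stripBlim T ^ 2 := by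
  have hD := one_sub_sq_mul_stripBlim_pos hT
  have h := stripYT_succ_sub_yStar_le_sharp hT
  have hB0 : 0 ≤ stripBlim T := stripBlim_nonneg hT
  have hB1 : stripBlim T ≤ 1 := stripBlim_le_one hT
  have hq : hexCriticalFugacity ^ 2 = 1 - Real.sqrt 2 / 2 := hexCriticalFugacity_sq_eq_one_sub
  have hs : Real.sqrt 2 * Real.sqrt 2 = 2 := Real.mul_self_sqrt (by norm_num)
  have hs1 : (1.41 : ℝ) < Real.sqrt 2 := by rw [Real.lt_sqrt (by norm_num)]; norm_num
  have hs2 : Real.sqrt 2 < 1.42 := by rw [Real.sqrt_lt' (by norm_num)]; norm_num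
  -- `u := x_c² B_T ≤ 1/2`
  set u := hexCriticalFugacity ^ 2 * stripBlim T with hu
  have hu0 : 0 ≤ u := by rw [hu, hq]; nlinarith
  have hu1 : u ≤ 1 / 2 := by rw [hu, hq]; nlinarith
  -- `(√2/2) B / (1 − u) ≤ (√2/2) B (1 + 2u)`
  have hkey : Real.sqrt 2 / 2 * stripBlim T / (1 - u) ≤ Real.sqrt 2 / 2 * stripBlim T * (1 + 2 * u) := by
    rw [div_le_iff₀ hD]
    have hA : 0 ≤ Real.sqrt 2 / 2 * stripBlim T := by positivity
    have h1 : (1 : ℝ) ≤ (1 + 2 * u) * (1 - u) := by nlinarith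
    nlinarith
  have e : Real.sqrt 2 / 2 * stripBlim T * (1 + 2 * u) =
      Real.sqrt 2 / 2 * stripBlim T + (Real.sqrt 2 - 1) * stripBlim T ^ 2 := by
    rw [hu, hq]; nlinarith [hs]
  linarith

/-- Numeric instance of the sharp bound at `T = 1`: **`y_2 − y* ≤ (√2/2)·(2√2 − 2)/(1 − x_c²(2√2 − 2)) = (4 + √2)/7 (= 0.7735…)`**,
with the tree's `B_1(x_c,1) = 2√2 − 2` (`HV.stripBlim_one_eq`, `HexSAWStripWidthOne`).  For comparison (not used): the exact value is
`y_2 − y* = (3 + √2)/7 = 0.6306…` (tree `HexSAWStripSurfaceWidthTwo.stripYT_two`), and Part I's round bound gives `0.8284…`.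
[cite: BeatonBousquetMelouDeGierDuminilCopinGuttmann2014, §4.5 (arXiv v5 p. 15); lane derivation] [cite: DuminilCopinSmirnov2012, §3 (B_1)] -/
theorem stripYT_two_sub_yStar_le_sharp_one : stripYT 2 - yStar ≤ (4 + Real.sqrt 2) / 7 := by
  have h := stripYT_succ_sub_yStar_le_sharp (T := 1) le_rfl
  rw [stripBlim_one_eq, hexCriticalFugacity_sq_eq_one_sub] at h
  have hs : Real.sqrt 2 * Real.sqrt 2 = 2 := Real.mul_self_sqrt (by norm_num)
  have e : Real.sqrt 2 / 2 * (2 * Real.sqrt 2 - 2) / (1 - (1 - Real.sqrt 2 / 2) * (2 * Real.sqrt 2 - 2)) =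
      (4 + Real.sqrt 2) / 7 := by
    have hd : (1 : ℝ) - (1 - Real.sqrt 2 / 2) * (2 * Real.sqrt 2 - 2) = 5 - 3 * Real.sqrt 2 := by nlinarith [hs]
    have hn : Real.sqrt 2 / 2 * (2 * Real.sqrt 2 - 2) = 2 - Real.sqrt 2 := by nlinarith [hs]
    rw [hd, hn]
    have hne : (5 : ℝ) - 3 * Real.sqrt 2 ≠ 0 := by
      have : Real.sqrt 2 < 1.5 := by rw [Real.sqrt_lt' (by norm_num)]; norm_num
      linarith
    rw [div_eq_div_iff hne (by norm_num)]
    nlinarith [hs]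
  linarith [e ▸ h]

end Literature.Probability.RandomPlanarGeometry.SAW.HV

end
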